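import Mathlib
import Literature.Computability.AlgebraicComplexity.PermanentIrreducible
import Literature.Computability.AlgebraicComplexity.StandardFamiliesProofs
import Literature.Computability.AlgebraicComplexity.ArithCircuitProofs
import Summits.ValiantsHypothesis.ValiantsHypothesis.Theorems.DivisionGapPerDivisionHardStubJssContraction

/-!
# Crux `DivisionGap.PerCofactorDegreeReduction` (stmt-ValiantsHypothesis-15046), line `Sketch` —
# stub `stub_conicCheapRelation`: a cheap nonnegative relation of degree `2^{k+1}` for the conic
# parametrisation at the angle `θ = π/2^{k+1}`

**Theorem (`stub_conicCheapRelation`).** Let `k ∈ ℕ`, `θ = π/2^{k+1}` and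
`Q_θ(z₀,z₁) = z₀² − 2cos θ·z₀z₁ + z₁²`.  There is a nonzero `G ∈ ℝ≥0[z₀,z₁,z₂]` with
`deg G ≤ 2^{k+1}`, circuit complexity `L(G) ≤ 2(k+3)²`, and
`G(y₀(y₀+y₁), y₁(y₀+y₁), −Q_θ(y₀,y₁)) = 0` in `ℝ[y₀,y₁]` (the companion of
`stub_parametrizedConicGap`, which forces `deg G ≥ π/(2θ) = 2^k` for every such `G`).

## Proof

Put `T_j = z₀^{2^{j+1}} + 2cos(2^jθ)·(z₀z₁)^{2^j} + z₁^{2^{j+1}}` (over `ℝ≥0` the middle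
coefficient is `(2cos(2^jθ)).toNNReal`, which is no clipping for `j ≤ k` since then
`0 ≤ 2^jθ ≤ π/2`, `cos_nonneg_of_le`, `map_factor`), `M_k = Π_{j<k} T_j` and
`G = z₀^{2^{k+1}} + z₁^{2^{k+1}} + z₂·((z₀+z₁)·M_k)`.
* Telescoping (`telescope`): `(z₀² − 2cos θ z₀z₁ + z₁²)·Π_{j<n} T_j =
  z₀^{2^{n+1}} − 2cos(2^nθ)(z₀z₁)^{2^n} + z₁^{2^{n+1}}`, by induction: with `A = z₀^{2^n}`,
  `B = z₁^{2^n}`, `c = 2cos(2^nθ)`, `(A² − cAB + B²)(A² + cAB + B²) = A⁴ + (2 − c²)A²B² + B⁴` and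
  `c² − 2 = 2cos(2^{n+1}θ)` (`Real.cos_two_mul`).  At `n = k`, `cos(2^kθ) = cos(π/2) = 0`, so
  `Q_θ · M_k = z₀^{2^{k+1}} + z₁^{2^{k+1}}` (`telescope_top`) and over `ℝ`
  `G = M_k · (Q_θ + z₂(z₀+z₁))` (`map_G`).
* The parametrisation kills the second factor: `Q_θ(y₀(y₀+y₁), y₁(y₀+y₁)) = (y₀+y₁)² Q_θ(y)` and
  `z₂(z₀+z₁) ↦ −Q_θ(y)(y₀+y₁)²` (`aeval_G`, `ring`).
* `G ≠ 0`: the coefficient of `z₀^{2^{k+1}}` is `≥ 1` over `ℝ≥0` (`G_ne_zero`).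
* `deg T_j ≤ 2^{j+1}`, `deg M_k ≤ 2^{k+1} − 2`, `deg G ≤ 2^{k+1}` (`totalDegree_G_le`).
* Cost by repeated squaring (`complexity_pow_two_pow_le`: `L(f^{2^j}) ≤ L(f) + j`, from
  `JssContraction.complexity_mul_self_le`) and the compositional bounds
  `complexity_add_le / mul_le / X / C`: `L(T_j) ≤ 3j + 6`, `2·L(M_n) ≤ 3n² + 11n`,
  `L(G) ≤ L(M_k) + 2k + 7 ≤ 2(k+3)²` (`complexity_G_le`).

No definitions: the family `T_j` enters the lemmas as any `S : ℕ → ℝ≥0[z]` (resp. `T : ℕ → ℝ[z]`)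
satisfying the defining equations `hS` (resp. `hT`).
-/

noncomputable section

-- `Summit.ValiantsHypothesis.ValiantsHypothesis.…` is the tree's mandated single-conjunct layout
-- (Problem = Summit), so the duplicated namespace component is intended.
set_option linter.dupNamespace false

namespace Summit.ValiantsHypothesis.ValiantsHypothesis.Theorems.DivisionGap.PerCofactorDegreeReduction.ConicCheapRelation

open MvPolynomial Literature.Computability.AlgebraicComplexity
open Summit.ValiantsHypothesis.ValiantsHypothesis.Theorems.DivisionGapPerDivisionHard.JssContraction
  (complexity_mul_self_le)
open scoped NNReal BigOperators

/-! ### Repeated squaring -/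

/-- Repeated squaring: `L(f^{2^j}) ≤ L(f) + j` (each squaring is one product gate reading its
input twice, `complexity_mul_self_le`). [folklore] -/
theorem complexity_pow_two_pow_le {K : Type*} [CommSemiring K] {σ : Type*}
    (f : MvPolynomial σ K) (j : ℕ) : complexity (f ^ 2 ^ j) ≤ complexity f + j := by
  induction j with
  | zero => simp
  | succ j ih =>
    rw [pow_succ, pow_mul, sq]
    exact (complexity_mul_self_le _).trans (by omega)

/-! ### Telescoping over `ℝ` -/

/-- **Telescoping.** With `T_j = z₀^{2^{j+1}} + 2cos(2^jθ)·(z₀z₁)^{2^j} + z₁^{2^{j+1}}`: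
`(z₀² − 2cos θ·z₀z₁ + z₁²) · Π_{j<n} T_j = z₀^{2^{n+1}} − 2cos(2^nθ)·(z₀z₁)^{2^n} + z₁^{2^{n+1}}`
(difference of squares and `cos 2x = 2cos² x − 1`). [folklore] -/
theorem telescope (θ : ℝ) (T : ℕ → MvPolynomial (Fin 3) ℝ)
    (hT : ∀ j, T j = X 0 ^ 2 ^ (j + 1) + C (2 * Real.cos (2 ^ j * θ)) * (X 0 * X 1) ^ 2 ^ j +
      X 1 ^ 2 ^ (j + 1)) (n : ℕ) :
    (X 0 ^ 2 - C (2 * Real.cos θ) * X 0 * X 1 + X 1 ^ 2) * ∏ j ∈ Finset.range n, T j =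
      X 0 ^ 2 ^ (n + 1) - C (2 * Real.cos (2 ^ n * θ)) * (X 0 * X 1) ^ 2 ^ n +
        X 1 ^ 2 ^ (n + 1) := by
  induction n with
  | zero =>
    simp only [Finset.prod_range_zero, mul_one, pow_zero, one_mul, zero_add, pow_one, mul_assoc]
  | succ n ih =>
    rw [Finset.prod_range_succ, ← mul_assoc, ih, hT n]
    have hcos : 2 * Real.cos (2 ^ (n + 1) * θ) = (2 * Real.cos (2 ^ n * θ)) ^ 2 - 2 := by
      rw [pow_succ, mul_comm ((2 : ℝ) ^ n) 2, mul_assoc, Real.cos_two_mul]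
      ring
    have hC : (C (2 * Real.cos (2 ^ (n + 1) * θ)) : MvPolynomial (Fin 3) ℝ) =
        C (2 * Real.cos (2 ^ n * θ)) ^ 2 - 2 := by
      rw [hcos, C_sub, C_pow, map_ofNat]
    have e0 : ∀ (x : MvPolynomial (Fin 3) ℝ) (m : ℕ), x ^ 2 ^ (m + 1) = (x ^ 2 ^ m) ^ 2 :=
      fun x m => by rw [pow_succ, pow_mul]
    rw [hC, e0 (X 0) (n + 1), e0 (X 1) (n + 1), e0 (X 0) n, e0 (X 1) n, e0 (X 0 * X 1) n,
      mul_pow (X 0) (X 1) (2 ^ n)]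
    generalize (X 0 : MvPolynomial (Fin 3) ℝ) ^ 2 ^ n = A
    generalize (X 1 : MvPolynomial (Fin 3) ℝ) ^ 2 ^ n = B
    ring

/-- At `θ = π/2^{k+1}` the product of the first `k` factors is an exact multiplier:
`(z₀² − 2cos θ·z₀z₁ + z₁²) · Π_{j<k} T_j = z₀^{2^{k+1}} + z₁^{2^{k+1}}`
(`cos(2^k θ) = cos(π/2) = 0`). [folklore] -/
theorem telescope_top (k : ℕ) (T : ℕ → MvPolynomial (Fin 3) ℝ)
    (hT : ∀ j, T j = X 0 ^ 2 ^ (j + 1) +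
      C (2 * Real.cos (2 ^ j * (Real.pi / 2 ^ (k + 1)))) * (X 0 * X 1) ^ 2 ^ j +
        X 1 ^ 2 ^ (j + 1)) :
    (X 0 ^ 2 - C (2 * Real.cos (Real.pi / 2 ^ (k + 1))) * X 0 * X 1 + X 1 ^ 2) *
        ∏ j ∈ Finset.range k, T j =
      X 0 ^ 2 ^ (k + 1) + X 1 ^ 2 ^ (k + 1) := by
  rw [telescope _ T hT]
  have h : (2 : ℝ) ^ k * (Real.pi / 2 ^ (k + 1)) = Real.pi / 2 := by
    rw [pow_succ]
    field_simp
  rw [h, Real.cos_pi_div_two, mul_zero, C_0, zero_mul, sub_zero]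

/-- The angles `2^j θ`, `j ≤ k`, `θ = π/2^{k+1}`, lie in `[0, π/2]`, so their cosines are
nonnegative. [folklore] -/
theorem cos_nonneg_of_le (k j : ℕ) (hj : j ≤ k) :
    0 ≤ Real.cos (2 ^ j * (Real.pi / 2 ^ (k + 1))) := by
  apply Real.cos_nonneg_of_neg_pi_div_two_le_of_le
  · have : (0 : ℝ) ≤ 2 ^ j * (Real.pi / 2 ^ (k + 1)) := by positivity
    linarith [Real.pi_pos]
  · have h2 : (2 : ℝ) ^ j ≤ 2 ^ k := pow_le_pow_right₀ (by norm_num) hj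
    have hk : (0 : ℝ) < 2 ^ k := by positivity
    rw [pow_succ, le_div_iff₀ (by norm_num : (0 : ℝ) < 2)]
    calc 2 ^ j * (Real.pi / (2 ^ k * 2)) * 2 = Real.pi * (2 ^ j / 2 ^ k) := by
          field_simp
      _ ≤ Real.pi * 1 := by
          gcongr
          exact (div_le_one hk).mpr h2
      _ = Real.pi := mul_one _

/-! ### From `ℝ≥0` to `ℝ` -/

/-- When `cos(2^j θ) ≥ 0` the nonnegative factor maps to the real one. [folklore] -/
theorem map_factor (θ : ℝ) (j : ℕ) (h : 0 ≤ Real.cos (2 ^ j * θ)) :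
    MvPolynomial.map NNReal.toRealHom
        (X 0 ^ 2 ^ (j + 1) + C (2 * Real.cos (2 ^ j * θ)).toNNReal * (X 0 * X 1) ^ 2 ^ j +
          X 1 ^ 2 ^ (j + 1) : MvPolynomial (Fin 3) ℝ≥0) =
      X 0 ^ 2 ^ (j + 1) + C (2 * Real.cos (2 ^ j * θ)) * (X 0 * X 1) ^ 2 ^ j +
        X 1 ^ 2 ^ (j + 1) := by
  have h2 : 0 ≤ 2 * Real.cos (2 ^ j * θ) := by positivity
  simp only [map_add, map_mul, map_pow, map_X, map_C, NNReal.coe_toRealHom,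
    Real.coe_toNNReal _ h2]

/-- The multiplier `M_k = Π_{j<k} T_j` over `ℝ≥0` maps to the real multiplier. [folklore] -/
theorem map_prod_factor (k : ℕ) (S : ℕ → MvPolynomial (Fin 3) ℝ≥0)
    (T : ℕ → MvPolynomial (Fin 3) ℝ)
    (hS : ∀ j, S j = X 0 ^ 2 ^ (j + 1) +
      C (2 * Real.cos (2 ^ j * (Real.pi / 2 ^ (k + 1)))).toNNReal * (X 0 * X 1) ^ 2 ^ j +
        X 1 ^ 2 ^ (j + 1))
    (hT : ∀ j, T j = X 0 ^ 2 ^ (j + 1) +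
      C (2 * Real.cos (2 ^ j * (Real.pi / 2 ^ (k + 1)))) * (X 0 * X 1) ^ 2 ^ j +
        X 1 ^ 2 ^ (j + 1)) :
    MvPolynomial.map NNReal.toRealHom (∏ j ∈ Finset.range k, S j) =
      ∏ j ∈ Finset.range k, T j := by
  rw [map_prod]
  refine Finset.prod_congr rfl fun j hj => ?_
  rw [hS, hT]
  exact map_factor _ _ (cos_nonneg_of_le k j (Finset.mem_range.mp hj).le)

/-- Over `ℝ`, `G = M_k · (Q_θ + z₂(z₀ + z₁))` with `Q_θ = z₀² − 2cos θ·z₀z₁ + z₁²`. [folklore] -/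
theorem map_G (k : ℕ) (S : ℕ → MvPolynomial (Fin 3) ℝ≥0) (T : ℕ → MvPolynomial (Fin 3) ℝ)
    (hS : ∀ j, S j = X 0 ^ 2 ^ (j + 1) +
      C (2 * Real.cos (2 ^ j * (Real.pi / 2 ^ (k + 1)))).toNNReal * (X 0 * X 1) ^ 2 ^ j +
        X 1 ^ 2 ^ (j + 1))
    (hT : ∀ j, T j = X 0 ^ 2 ^ (j + 1) +
      C (2 * Real.cos (2 ^ j * (Real.pi / 2 ^ (k + 1)))) * (X 0 * X 1) ^ 2 ^ j +
        X 1 ^ 2 ^ (j + 1)) :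
    MvPolynomial.map NNReal.toRealHom
        (X 0 ^ 2 ^ (k + 1) + X 1 ^ 2 ^ (k + 1) +
          X 2 * ((X 0 + X 1) * ∏ j ∈ Finset.range k, S j)) =
      (∏ j ∈ Finset.range k, T j) *
        ((X 0 ^ 2 - C (2 * Real.cos (Real.pi / 2 ^ (k + 1))) * X 0 * X 1 + X 1 ^ 2) +
          X 2 * (X 0 + X 1)) := by
  simp only [map_add, map_mul, map_pow, map_X, map_prod_factor k S T hS hT]
  -- `map_mul` also split the coefficient `C (2 * cos θ)`; fold it back before telescoping.
  rw [← C_mul, ← telescope_top k T hT]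
  ring

/-- `G` kills the parametrisation `(y₀(y₀+y₁), y₁(y₀+y₁), −Q_θ(y₀,y₁))`: its second real
factor becomes `(y₀+y₁)² Q_θ(y) − Q_θ(y) (y₀+y₁)² = 0`. [folklore] -/
theorem aeval_G (k : ℕ) (S : ℕ → MvPolynomial (Fin 3) ℝ≥0)
    (hS : ∀ j, S j = X 0 ^ 2 ^ (j + 1) +
      C (2 * Real.cos (2 ^ j * (Real.pi / 2 ^ (k + 1)))).toNNReal * (X 0 * X 1) ^ 2 ^ j +
        X 1 ^ 2 ^ (j + 1)) :
    MvPolynomial.aeval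
        (![X 0 * (X 0 + X 1), X 1 * (X 0 + X 1),
           -(X 0 ^ 2 - C (2 * Real.cos (Real.pi / 2 ^ (k + 1))) * X 0 * X 1 + X 1 ^ 2)] :
          Fin 3 → MvPolynomial (Fin 2) ℝ)
        (MvPolynomial.map NNReal.toRealHom
          (X 0 ^ 2 ^ (k + 1) + X 1 ^ 2 ^ (k + 1) +
            X 2 * ((X 0 + X 1) * ∏ j ∈ Finset.range k, S j))) = 0 := by
  obtain ⟨T, hT⟩ : ∃ T : ℕ → MvPolynomial (Fin 3) ℝ, ∀ j, T j = X 0 ^ 2 ^ (j + 1) +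
      C (2 * Real.cos (2 ^ j * (Real.pi / 2 ^ (k + 1)))) * (X 0 * X 1) ^ 2 ^ j +
        X 1 ^ 2 ^ (j + 1) :=
    ⟨_, fun _ => rfl⟩
  rw [map_G k S T hS hT, map_mul]
  refine mul_eq_zero_of_right _ ?_
  simp only [map_add, map_sub, map_mul, map_pow, aeval_X, aeval_C, algebraMap_eq,
    Matrix.cons_val_zero, Matrix.cons_val_one, Matrix.cons_val_two, Matrix.head_cons,
    Matrix.tail_cons]
  ring

/-! ### Nonvanishing and degree over `ℝ≥0` -/

/-- `G ≠ 0`: its `z₀^{2^{k+1}}`-coefficient is `≥ 1` (no cancellation over `ℝ≥0`). [folklore] -/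
theorem G_ne_zero (k : ℕ) (M : MvPolynomial (Fin 3) ℝ≥0) :
    (X 0 ^ 2 ^ (k + 1) + X 1 ^ 2 ^ (k + 1) + X 2 * ((X 0 + X 1) * M) :
      MvPolynomial (Fin 3) ℝ≥0) ≠ 0 := by
  refine MvPolynomial.ne_zero_iff.mpr ⟨Finsupp.single 0 (2 ^ (k + 1)), ?_⟩
  rw [coeff_add, coeff_add, coeff_X_pow, if_pos rfl, add_assoc]
  exact ne_of_gt (lt_of_lt_of_le zero_lt_one le_self_add)

/-- `deg T_j ≤ 2^{j+1}` (any middle coefficient). [folklore] -/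
theorem totalDegree_factor_le (c : ℝ≥0) (j : ℕ) :
    (X 0 ^ 2 ^ (j + 1) + C c * (X 0 * X 1) ^ 2 ^ j + X 1 ^ 2 ^ (j + 1) :
      MvPolynomial (Fin 3) ℝ≥0).totalDegree ≤ 2 ^ (j + 1) := by
  refine (totalDegree_add _ _).trans (max_le ((totalDegree_add _ _).trans (max_le ?_ ?_)) ?_)
  · rw [totalDegree_X_pow]
  · refine (totalDegree_mul _ _).trans ?_
    rw [totalDegree_C, zero_add]
    refine (totalDegree_pow _ _).trans ?_
    refine (Nat.mul_le_mul_left _ (totalDegree_mul _ _)).trans ?_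
    rw [totalDegree_X, totalDegree_X, pow_succ]
  · rw [totalDegree_X_pow]

/-- `deg Π_{j<n} T_j ≤ 2^{n+1} − 2`. [folklore] -/
theorem totalDegree_prod_le (θ : ℝ) (S : ℕ → MvPolynomial (Fin 3) ℝ≥0)
    (hS : ∀ j, S j = X 0 ^ 2 ^ (j + 1) +
      C (2 * Real.cos (2 ^ j * θ)).toNNReal * (X 0 * X 1) ^ 2 ^ j + X 1 ^ 2 ^ (j + 1)) (n : ℕ) :
    (∏ j ∈ Finset.range n, S j).totalDegree + 2 ≤ 2 ^ (n + 1) := by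
  induction n with
  | zero => simp
  | succ n ih =>
    have h1 := totalDegree_mul (∏ j ∈ Finset.range n, S j) (S n)
    have h2 : (S n).totalDegree ≤ 2 ^ (n + 1) := by
      rw [hS]
      exact totalDegree_factor_le _ _
    rw [Finset.prod_range_succ, pow_succ]
    generalize 2 ^ (n + 1) = N at h1 h2 ih ⊢
    omega

/-- `deg G ≤ 2^{k+1}` as soon as `deg M ≤ 2^{k+1} − 2`. [folklore] -/
theorem totalDegree_G_le (k : ℕ) (M : MvPolynomial (Fin 3) ℝ≥0)
    (hM : M.totalDegree + 2 ≤ 2 ^ (k + 1)) :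
    (X 0 ^ 2 ^ (k + 1) + X 1 ^ 2 ^ (k + 1) + X 2 * ((X 0 + X 1) * M) :
      MvPolynomial (Fin 3) ℝ≥0).totalDegree ≤ 2 ^ (k + 1) := by
  have hx : (X 0 + X 1 : MvPolynomial (Fin 3) ℝ≥0).totalDegree ≤ 1 :=
    (totalDegree_add _ _).trans (max_le (totalDegree_X _).le (totalDegree_X _).le)
  refine (totalDegree_add _ _).trans (max_le ((totalDegree_add _ _).trans (max_le ?_ ?_)) ?_)
  · rw [totalDegree_X_pow]
  · rw [totalDegree_X_pow]
  · refine (totalDegree_mul _ _).trans ?_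
    refine (add_le_add (totalDegree_X _).le (totalDegree_mul _ _)).trans ?_
    omega

/-! ### Cost -/

/-- `L(T_j) ≤ 3j + 6` by repeated squaring (any middle coefficient). [folklore] -/
theorem complexity_factor_le (c : ℝ≥0) (j : ℕ) :
    complexity (X 0 ^ 2 ^ (j + 1) + C c * (X 0 * X 1) ^ 2 ^ j + X 1 ^ 2 ^ (j + 1) :
      MvPolynomial (Fin 3) ℝ≥0) ≤ 3 * j + 6 := by
  have h0 : complexity (X 0 : MvPolynomial (Fin 3) ℝ≥0) = 0 := complexity_X_holds 0
  have h1 : complexity (X 1 : MvPolynomial (Fin 3) ℝ≥0) = 0 := complexity_X_holds 1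
  have hA := complexity_pow_two_pow_le (X 0 : MvPolynomial (Fin 3) ℝ≥0) (j + 1)
  have hB := complexity_pow_two_pow_le (X 1 : MvPolynomial (Fin 3) ℝ≥0) (j + 1)
  have hP := complexity_pow_two_pow_le (X 0 * X 1 : MvPolynomial (Fin 3) ℝ≥0) j
  have hP1 := complexity_mul_le_holds (X 0 : MvPolynomial (Fin 3) ℝ≥0) (X 1)
  have hC : complexity (C c : MvPolynomial (Fin 3) ℝ≥0) = 0 := complexity_C_holds _
  have hCP := complexity_mul_le_holds (C c : MvPolynomial (Fin 3) ℝ≥0) ((X 0 * X 1) ^ 2 ^ j)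
  have hS1 := complexity_add_le_holds (X 0 ^ 2 ^ (j + 1) : MvPolynomial (Fin 3) ℝ≥0)
    (C c * (X 0 * X 1) ^ 2 ^ j)
  have hS2 := complexity_add_le_holds
    (X 0 ^ 2 ^ (j + 1) + C c * (X 0 * X 1) ^ 2 ^ j : MvPolynomial (Fin 3) ℝ≥0)
    (X 1 ^ 2 ^ (j + 1))
  omega

/-- `2·L(Π_{j<n} T_j) ≤ 3n² + 11n`. [folklore] -/
theorem complexity_prod_le (θ : ℝ) (S : ℕ → MvPolynomial (Fin 3) ℝ≥0)
    (hS : ∀ j, S j = X 0 ^ 2 ^ (j + 1) +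
      C (2 * Real.cos (2 ^ j * θ)).toNNReal * (X 0 * X 1) ^ 2 ^ j + X 1 ^ 2 ^ (j + 1)) (n : ℕ) :
    complexity (∏ j ∈ Finset.range n, S j) * 2 ≤ 3 * n ^ 2 + 11 * n := by
  induction n with
  | zero =>
    have : complexity (1 : MvPolynomial (Fin 3) ℝ≥0) = 0 := by
      rw [← C_1]
      exact complexity_C_holds _
    simp [this]
  | succ n ih =>
    have h1 := complexity_mul_le_holds (∏ j ∈ Finset.range n, S j) (S n)
    have h2 : complexity (S n) ≤ 3 * n + 6 := by
      rw [hS]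
      exact complexity_factor_le _ _
    have e : 3 * (n + 1) ^ 2 + 11 * (n + 1) = 3 * n ^ 2 + 11 * n + (6 * n + 14) := by ring
    rw [Finset.prod_range_succ, e]
    generalize n ^ 2 = N at ih ⊢
    omega

/-- `L(G) ≤ 2(k+3)²` as soon as `2·L(M) ≤ 3k² + 11k`. [folklore] -/
theorem complexity_G_le (k : ℕ) (M : MvPolynomial (Fin 3) ℝ≥0)
    (hM : complexity M * 2 ≤ 3 * k ^ 2 + 11 * k) :
    complexity (X 0 ^ 2 ^ (k + 1) + X 1 ^ 2 ^ (k + 1) + X 2 * ((X 0 + X 1) * M) :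
      MvPolynomial (Fin 3) ℝ≥0) ≤ 2 * (k + 3) ^ 2 := by
  have h0 : complexity (X 0 : MvPolynomial (Fin 3) ℝ≥0) = 0 := complexity_X_holds 0
  have h1 : complexity (X 1 : MvPolynomial (Fin 3) ℝ≥0) = 0 := complexity_X_holds 1
  have h2 : complexity (X 2 : MvPolynomial (Fin 3) ℝ≥0) = 0 := complexity_X_holds 2
  have hA := complexity_pow_two_pow_le (X 0 : MvPolynomial (Fin 3) ℝ≥0) (k + 1)
  have hB := complexity_pow_two_pow_le (X 1 : MvPolynomial (Fin 3) ℝ≥0) (k + 1)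
  have hS := complexity_add_le_holds (X 0 : MvPolynomial (Fin 3) ℝ≥0) (X 1)
  have hSM := complexity_mul_le_holds (X 0 + X 1 : MvPolynomial (Fin 3) ℝ≥0) M
  have h2M := complexity_mul_le_holds (X 2 : MvPolynomial (Fin 3) ℝ≥0) ((X 0 + X 1) * M)
  have hAB := complexity_add_le_holds (X 0 ^ 2 ^ (k + 1) : MvPolynomial (Fin 3) ℝ≥0)
    (X 1 ^ 2 ^ (k + 1))
  have hG := complexity_add_le_holds (X 0 ^ 2 ^ (k + 1) + X 1 ^ 2 ^ (k + 1) :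
    MvPolynomial (Fin 3) ℝ≥0) (X 2 * ((X 0 + X 1) * M))
  have e : 2 * (k + 3) ^ 2 = 2 * k ^ 2 + 12 * k + 18 := by ring
  rw [e]
  generalize k ^ 2 = K at hM ⊢
  omega

/-! ### The registered stub -/

/-- **stub_conicCheapRelation.** For `θ = π/2^{k+1}` there is a nonzero `G ∈ ℝ≥0[z₀,z₁,z₂]` of
degree `≤ 2^{k+1}` and cost `≤ 2(k+3)²` killing the parametrisation
`(y₀(y₀+y₁), y₁(y₀+y₁), −(y₀² − 2cos θ·y₀y₁ + y₁²))`: `G = z₀^{2^{k+1}} + z₁^{2^{k+1}} +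
z₂(z₀+z₁)·Π_{j<k}(z₀^{2^{j+1}} + 2cos(2^jθ)(z₀z₁)^{2^j} + z₁^{2^{j+1}})`. [folklore] -/
theorem stub_conicCheapRelation (k : ℕ) :
    ∃ G : MvPolynomial (Fin 3) ℝ≥0, G ≠ 0 ∧ G.totalDegree ≤ 2 ^ (k + 1) ∧
      complexity G ≤ 2 * (k + 3) ^ 2 ∧
      MvPolynomial.aeval
        (![X 0 * (X 0 + X 1), X 1 * (X 0 + X 1),
           -(X 0 ^ 2 - C (2 * Real.cos (Real.pi / 2 ^ (k + 1))) * X 0 * X 1 + X 1 ^ 2)] :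
          Fin 3 → MvPolynomial (Fin 2) ℝ) (MvPolynomial.map NNReal.toRealHom G) = 0 := by
  obtain ⟨S, hS⟩ : ∃ S : ℕ → MvPolynomial (Fin 3) ℝ≥0, ∀ j, S j = X 0 ^ 2 ^ (j + 1) +
      C (2 * Real.cos (2 ^ j * (Real.pi / 2 ^ (k + 1)))).toNNReal * (X 0 * X 1) ^ 2 ^ j +
        X 1 ^ 2 ^ (j + 1) :=
    ⟨_, fun _ => rfl⟩
  exact ⟨_, G_ne_zero k (∏ j ∈ Finset.range k, S j),
    totalDegree_G_le k _ (totalDegree_prod_le _ S hS k),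
    complexity_G_le k _ (complexity_prod_le _ S hS k), aeval_G k S hS⟩

end Summit.ValiantsHypothesis.ValiantsHypothesis.Theorems.DivisionGap.PerCofactorDegreeReduction.ConicCheapRelation

end
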